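import Summits.Ventures.HodgeRepro2.T5SU11SphericalTransformKernelComp

/-!
# The masses of the kernel and of the composed kernels: `∫ K_λ^{∘(k+1)}(t, s) sinh 2s ds = (−1/μ)^{k+1}` for `λ > 2`,
and the radius of the spherical transform of the Neumann series

The constant function `1 = φ_2` is the spherical function of the parameter `λ′ = 2` (`μ′ = 0`), which lies in `(1, λ)` exactly when
`λ > 2`; row 630's transform of the composed kernels then reads

* `integral_kernel_mul_sinh_eq` — **`∫_0^∞ K_λ(t, s) sinh 2s ds = −1/(λ(λ − 2)) = −1/μ`** for `λ > 2` (the mass of the kernel's row: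
  the resolvent of the constant source, row 544, in kernel form);
* `integral_kernel_comp_mul_sinh_eq` — **`∫_0^∞ K_λ^{∘(k+1)}(t, s) sinh 2s ds = (−1/μ)^{k+1}`**;
* `summable_transform_kernel_comp_iff` — **the spherical transform of the Neumann series `Σ_k c^k K_λ^{∘(k+1)}` against `φ_{λ′}`
  converges iff `|c| < |μ′ − μ|`** (`1 < λ′ < λ`): the transforms are `c^k φ_{λ′}(a_t)/(μ′ − μ)^{k+1}`, a geometric series of ratio
  `c/(μ′ − μ)` with a non-zero first term (rows 607/630).

Nothing is claimed about (N).

Blind lane: Mathlib + the HodgeRepro2 prefix only; no sorry; axioms ⊆ {propext, Classical.choice,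
Quot.sound}.
-/

namespace Summit.Ventures.HodgeRepro2.T5SU11KernelMass

open Filter Topology MeasureTheory
open Set (Ioi Ioc)
open T5SU11Cartan T5SU11SphericalFunction T5SU11SphericalBounds T5SU11SphericalTwo T5SU11SphericalDecay
  T5SU11RadialGreenKernel T5SU11RadialGreenImproper T5SU11SphericalTransformKernelComp

section measure

variable [MeasurableSpace Circle] [BorelSpace Circle]

variable {lam : ℝ} (h2 : 2 < lam)

include h2 in
/-- **`∫_0^∞ K_λ^{∘(k+1)}(t, s) sinh 2s ds = (−1/(λ(λ − 2)))^{k+1}`** for `λ > 2`, `t > 0`. -/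
theorem integral_kernel_comp_mul_sinh_eq {t : ℝ} (ht : 0 < t) (k : ℕ) :
    ∫ s in Ioi 0, ((greenSolI (fun t => sph lam (hyp t)) (sphDecay lam))^[k] (fun u => sphGreenKernel lam u s)) t
        * Real.sinh (2 * s)
      = (-(1 / (lam * (lam - 2)))) ^ (k + 1) := by
  have hlam : 1 < lam := by linarith
  have h := integral_kernel_comp_mul_sph (lam' := 2) hlam (by norm_num) h2 ht k
  have e : (fun s => ((greenSolI (fun t => sph lam (hyp t)) (sphDecay lam))^[k] (fun u => sphGreenKernel lam u s)) t
      * sph 2 (hyp s) * Real.sinh (2 * s))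
      = fun s => ((greenSolI (fun t => sph lam (hyp t)) (sphDecay lam))^[k] (fun u => sphGreenKernel lam u s)) t
      * Real.sinh (2 * s) := by
    funext s
    rw [sph_two, mul_one]
  rw [e] at h
  rw [h, sph_two, mul_one]
  congr 1
  norm_num

include h2 in
/-- **The mass of the kernel's row: `∫_0^∞ K_λ(t, s) sinh 2s ds = −1/(λ(λ − 2))`** for `λ > 2`, `t > 0`. -/
theorem integral_kernel_mul_sinh_eq {t : ℝ} (ht : 0 < t) :
    ∫ s in Ioi 0, sphGreenKernel lam t s * Real.sinh (2 * s) = -(1 / (lam * (lam - 2))) := by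
  have h := integral_kernel_comp_mul_sinh_eq h2 ht 0
  simpa only [Function.iterate_zero, id_eq, zero_add, pow_one] using h

omit h2 in
/-- **The radius of the spherical transform of the Neumann series**: for `1 < λ′ < λ`, `t > 0` and a constant `c`,
`Σ_k c^k ∫ K_λ^{∘(k+1)}(t, s) φ_{λ′}(a_s) sinh 2s ds` converges iff `|c| < |μ′ − μ|`. -/
theorem summable_transform_kernel_comp_iff (hlam : 1 < lam) {lam' : ℝ} (h1 : 1 < lam') (h2' : lam' < lam)
    {t : ℝ} (ht : 0 < t) (c : ℝ) :
    Summable (fun k : ℕ => c ^ k * ∫ s in Ioi 0,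
        ((greenSolI (fun t => sph lam (hyp t)) (sphDecay lam))^[k] (fun u => sphGreenKernel lam u s)) t
          * sph lam' (hyp s) * Real.sinh (2 * s))
      ↔ |c| < |lam' * (lam' - 2) - lam * (lam - 2)| := by
  have hκ : lam' * (lam' - 2) - lam * (lam - 2) ≠ 0 := by
    have e : lam' * (lam' - 2) - lam * (lam - 2) = (lam' - lam) * (lam' + lam - 2) := by ring
    rw [e]
    exact mul_ne_zero (by linarith) (by linarith)
  have hφ : sph lam' (hyp t) ≠ 0 := (sph_hyp_pos lam' t).ne'
  set q := 1 / (lam' * (lam' - 2) - lam * (lam - 2)) with hq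
  have hq0 : q ≠ 0 := one_div_ne_zero hκ
  have e : ∀ k : ℕ, c ^ k * ∫ s in Ioi 0,
      ((greenSolI (fun t => sph lam (hyp t)) (sphDecay lam))^[k] (fun u => sphGreenKernel lam u s)) t
        * sph lam' (hyp s) * Real.sinh (2 * s)
      = (q * sph lam' (hyp t)) * (c * q) ^ k := by
    intro k
    rw [integral_kernel_comp_mul_sph hlam h1 h2' ht k, pow_succ, mul_pow]
    ring
  simp_rw [e]
  rw [summable_mul_left_iff (mul_ne_zero hq0 hφ), summable_geometric_iff_norm_lt_one, Real.norm_eq_abs, abs_mul, hq,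
    abs_div, abs_one, mul_one_div, div_lt_one (abs_pos.mpr hκ)]

end measure

end Summit.Ventures.HodgeRepro2.T5SU11KernelMass
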